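import Summits.Ventures.QEC.Thresholds.ToricCodePhenomenologicalThresholds
import Literature.InformationTheory.QuantumCodes.HypergraphProductGallagerFamily
import Literature.InformationTheory.QuantumCodes.CSSPhenomenologicalRadius
import HarnessLib

/-!
# Certified thresholds of a POSITIVE-RATE quantum LDPC family (hypergraph products of Gallager's good
# classical LDPC codes): code capacity `p₀(11) ≈ .00207`, erasure `1/11`, phenomenological `p₀(13)`

Venture QEC, `Summits/Ventures/QEC/Thresholds/` (LADDER-QEC rung Q5 × "qLDPC families"; qec-lit-2 gen 3).
Packaging of `HypergraphProductGallagerFamily.lean` (Literature): the Tillich–Zémor Theorem-1 family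
`HGP(G_j, G_jᵀ)` built from the tree's PROVED existence theorem for good classical LDPC codes
(`Coding.exists_goodLDPCMatrix_minDist`; the tree also proves TZ's family statement itself,
`TillichZemor2014_hgp_sqrt_distance_holds`, in `GoodQLDPCFromHypergraphProduct.lean`) — `N_j ≤ 8 n_j²` qubits
(`n_j = 650(j+1)`), `X`-checks of weight `≤ 12`, `k = (2n_j - r_j)² ≥ (n_j/8)²` logical qubits (rate `≥ 1/512`),
distance of the `H_X`-detected sector `≥ j + 2`, a non-trivial logical (`gallager_exists_logical`). HONEST
FRAMING: UNCONDITIONAL, kernel axioms, no named fact, no `native_decide`; the family EXISTS (choice) and is not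
explicit; one error type; the constants are the Dumer–Kovalev–Pryadko cluster constants for check weight `12`:

| noise model | certified lower bound | theorem |
|---|---|---|
| code capacity, every minimum-weight decoder family | `p₀(11) = (1-√(1-1/121))/2 > .002` | `gallager_isThresholdLowerBound` |
| erasures | `1/11` | `gallager_erasure_isThresholdLowerBound` |
| phenomenological `q = p`, `T(j)` polynomial | `p₀(13) > .0014` | `gallager_phenom_isThresholdLowerBound` |

## References

* [TillichZemor2014] J.-P. Tillich, G. Zémor, IEEE Trans. IT 60 (2014) 1193, Thm 1.
* [Gallager1963] R. G. Gallager, *Low-Density Parity-Check Codes*, MIT Press 1963, Ch. 2.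
* [DumerKovalevPryadko2015] I. Dumer, A. A. Kovalev, L. P. Pryadko, PRL 115 (2015) 050502, Thms 2–3.
-/

noncomputable section

namespace Summit.Ventures.QEC.Thresholds

open Filter Topology Finset Matrix
open Literature.InformationTheory.QuantumCodes

open Classical in
/-- Failure probabilities of a decoder family for the `H_X`-detected sector of the Gallager–Tillich–Zémor family.
[cite: DumerKovalevPryadko2015, eq. (succesful-decoding)] -/
def gallagerFailureFamily (D : ∀ j, Decoder (GallagerCheck j → ZMod 2) (GallagerQubit j → ZMod 2)) :
    ℕ → ℝ → ℝ :=
  fun j p => ∑ e ∈ univ.filter (fun e : GallagerQubit j → ZMod 2 =>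
    ¬ (D j).Corrects (fun e => gallagerHX j *ᵥ e) (gallagerSZ j : Set (GallagerQubit j → ZMod 2)) e),
    bernoulliWeight p (supp e)

/-- **Code-capacity threshold `≥ p₀(11)` of the positive-rate Gallager–TZ family**, for EVERY family of
minimum-weight decoders. UNCONDITIONAL. [cite: DumerKovalevPryadko2015, Thm 2 (y = 0, w = 12)] -/
theorem gallager_isThresholdLowerBound (D : ∀ j, Decoder (GallagerCheck j → ZMod 2) (GallagerQubit j → ZMod 2))
    (hD : ∀ j, (D j).IsMinWeight (fun e => gallagerHX j *ᵥ e) {x | gallagerHX j *ᵥ x = 0} hammingNorm) :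
    IsThresholdLowerBound (gallagerFailureFamily D) (thresholdValue 11) := by
  intro p hp₀ hpp
  have hp : p ≤ 1 / 2 := le_trans hpp.le (thresholdValue_le_half 11)
  have hsum : p + thresholdValue 11 < 1 := by
    have := thresholdValue_le_half (11 : ℝ)
    linarith
  have hlt := mul_one_sub_lt_mul_one_sub hpp hsum
  have h := four_mul_sq_mul_thresholdValue (ν := 11) (by norm_num)
  have h484 : 484 * (p * (1 - p)) < 1 := by nlinarith
  exact gallagerHGP_codeCapacityThreshold D hD hp₀ hp h484

/-- Non-vacuity of the decoder class: the canonical minimum-weight decoder qualifies.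
[cite: DumerKovalevPryadko2015, p. 3 (exhaustive search decoder)] -/
theorem gallager_isMinWeight_minWeight (j : ℕ) :
    (Decoder.minWeight (fun e : GallagerQubit j → ZMod 2 => gallagerHX j *ᵥ e) hammingNorm).IsMinWeight
      (fun e => gallagerHX j *ᵥ e) {x | gallagerHX j *ᵥ x = 0} hammingNorm := by
  refine Decoder.isMinWeight_minWeight _ _ _ (fun y z h => ?_) (fun x => ?_)
  · show gallagerHX j *ᵥ (y - z) = 0
    rw [Matrix.mulVec_sub]
    have h' : gallagerHX j *ᵥ y = gallagerHX j *ᵥ z := h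
    rw [h', sub_self]
  · rw [show -x = x from funext fun i => ZMod.neg_eq_self_mod_two (x i)]

/-- Decimal certificate: `.002 < p₀(11)`. [cite: DennisEtAl2002, §5.3 eq. (threshold_2d) (with ν = 11)] -/
theorem thresholdValue_eleven_gt : (0.002 : ℝ) < thresholdValue 11 := by
  unfold thresholdValue
  have : Real.sqrt (1 - 1 / (11 : ℝ) ^ 2) < 0.996 := by
    rw [Real.sqrt_lt' (by norm_num)]
    norm_num
  linarith

/-- **`p_c > .002`** for the positive-rate Gallager–TZ family under minimum-weight decoding (kernel).
[cite: DumerKovalevPryadko2015, Thm 2 (y = 0, w = 12)] -/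
theorem gallager_accuracyThreshold_gt (D : ∀ j, Decoder (GallagerCheck j → ZMod 2) (GallagerQubit j → ZMod 2))
    (hD : ∀ j, (D j).IsMinWeight (fun e => gallagerHX j *ᵥ e) {x | gallagerHX j *ᵥ x = 0} hammingNorm) :
    (0.002 : ℝ) < accuracyThreshold (gallagerFailureFamily D) :=
  lt_of_lt_of_le thresholdValue_eleven_gt
    (le_accuracyThreshold (gallager_isThresholdLowerBound D hD) ((thresholdValue_le_half 11).trans (by norm_num)))

/-- The erasure family of the Gallager–TZ codes (probability that the loss pattern is uncorrectable).
[cite: DumerKovalevPryadko2015, Thm 2 (erasure part)] -/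
def gallagerErasureFamily : ℕ → ℝ → ℝ :=
  fun j y => ErasureDecoder.uncorrectableProb {x : GallagerQubit j → ZMod 2 | gallagerHX j *ᵥ x = 0}
    (gallagerSZ j : Set (GallagerQubit j → ZMod 2)) y

/-- **Erasure threshold `≥ 1/11`** of the positive-rate family. UNCONDITIONAL.
[cite: DumerKovalevPryadko2015, Thm 2 (erasure part, w = 12)] -/
theorem gallager_erasure_isThresholdLowerBound : IsThresholdLowerBound gallagerErasureFamily (1 / 11) :=
  fun _ hy₀ hy => gallagerHGP_erasureThreshold hy₀ (by linarith)

/-- The phenomenological failure family (`q = p`, `T(j)` rounds). [cite: DennisEtAl2002, §5.2 (Prob_fail)] -/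
def gallagerPhenomFailureFamily (T : ℕ → ℕ)
    (D : ∀ j, CSSPhenom.STDecoder (GallagerCheck j) (GallagerQubit j) (T j)) : ℕ → ℝ → ℝ :=
  fun j p => CSSPhenom.phenomFailureProb (gallagerHX j) (T j) (gallagerSZ j : Set (GallagerQubit j → ZMod 2))
    (D j) p p

/-- **Phenomenological threshold `≥ p₀(13)`** of the positive-rate family for every polynomially bounded
schedule and every minimum-weight space-time decoder family. UNCONDITIONAL.
[cite: DumerKovalevPryadko2015, Thm 3 with p. 5 (w → w + 2)] -/
theorem gallager_phenom_isThresholdLowerBound {T : ℕ → ℕ} (hT : ToricCode.IsPolyBounded T)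
    {D : ∀ j, CSSPhenom.STDecoder (GallagerCheck j) (GallagerQubit j) (T j)}
    (hD : ∀ j, (D j).IsMinWeight (CSSPhenom.stSyn (gallagerHX j) (T j))
      (CSSPhenom.stCycles (gallagerHX j) (T j)) hammingNorm) :
    IsThresholdLowerBound (gallagerPhenomFailureFamily T D) (thresholdValue 13) := by
  intro p hp₀ hpp
  have hp : p ≤ 1 / 2 := le_trans hpp.le (thresholdValue_le_half 13)
  have hsum : p + thresholdValue 13 < 1 := by
    have := thresholdValue_le_half (13 : ℝ)
    linarith
  have hlt := mul_one_sub_lt_mul_one_sub hpp hsum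
  have h := four_mul_sq_mul_thresholdValue (ν := 13) (by norm_num)
  have h676 : 676 * (p * (1 - p)) < 1 := by nlinarith
  exact gallagerHGP_phenomThreshold T hT D hD hp₀ hp h676

/-- Decimal certificate: `.0014 < p₀(13)`. [cite: DennisEtAl2002, §5.3 eq. (threshold_2d) (with ν = 13)] -/
theorem thresholdValue_thirteen_gt : (0.0014 : ℝ) < thresholdValue 13 := by
  unfold thresholdValue
  have : Real.sqrt (1 - 1 / (13 : ℝ) ^ 2) < 0.9972 := by
    rw [Real.sqrt_lt' (by norm_num)]
    norm_num
  linarith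

end Summit.Ventures.QEC.Thresholds
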